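import Literature.NumberTheory.Automorphic.ArchLocalSplitSingularTorusFibres      -- ★ FILE D p840796 (F0P3a-p05): `mk_circleDiagonal_comp_eq_mk_swap_pos_iff`, the counts `2p` ∕ `2·#{e<0}`; brings ★ FILE B, ★ B-p17 classes, ★ FILE A signs
import HarnessLib

/-!
# The per-place CLASS COEFFICIENTS of the end state: a fibre sum of the wall weights `κ_v(σ)·λ_v(σ)` is `−2·M_v·p_v!(3−p_v)!` times the Kottwitz sign of the class
# ((R1-h-d) (D2-eval); Rogawski 1990 §8.2 Prop. 8.2.1 p. 118, pp. 122–124, §4.1 (4.1.2))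

Topic `NumberTheory/Rogawski1990`; namespace `Literature.NumberTheory.Rogawski1990`.  THEOREMS ONLY (no `def`, no instance, no notation, no axiom, no named fact, no `sorry`);
finite book-keeping over ★ FILE D∕B (F0P3a-p05), ★ B-p17 (V8)-sing classes and ★ FILE A signs.  Cell `pub/hodgecm-mathlib`, ENGINE T1 (crux H413 = `stmt-HodgeConjecture-24833`); floor-2
road «(J-nc) in-house», brick (D2-eval) of (R1-h-d) (LEAD F0P3a-plan (g9) WORD T8-119∕T8-120; F0P3-p03 (g9) «=» 07:08:40Z); author F0P3a-p07 (g8), 2026-09-01.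

WHAT.  At a place `w` with real non-zero weights `σ_w α_i` and a wall point `z⁰` (`z⁰_0 = z⁰_2 ≠ z⁰_1`), the end state of the «method of §8.2» weighs the relabelling `σ ∈ S₃` by
`w(σ) = κ(σ)·λ(σ)` with `κ(σ) = (cw σ ? 2 : c(σ))`, `λ(σ) = (cw σ ? mass(σ) : 1)`, `cw σ :⇔ 0 < re σ_w(α_{σ⁻¹0})·re σ_w(α_{σ⁻¹2})` (the pair of coalescing eigenvalues sits in slots of the same
sign — compact centraliser `U(2) × U(1)`).  ANALYTIC INPUT, as hypotheses: the noncompact constants have ONE value `c(σ) = −M` and the compact masses ONE value `mass(σ) = M` ((b1) ★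
p842004 + (b2′) ★ p842051 + uniqueness ★ p841778 and the VALUE (J-val) «`c = −(mass)`», for coherently transported centraliser measures).  THEN for every `r` the sum of `w` over the
fibre `{σ ∣ ⟦diag(z⁰∘σ)⟧ = ⟦diag(z⁰∘r)⟧}` of `G_w(α)` is **`−2·M·p!(3−p)! · e(diag(z⁰∘r))`**, `p = #{i ∣ 0 < re σ_w α_i}` — exactly the hypothesis `hΛ` of ★-to-be (D2-comb)
`sum_univ_prod_mul_classOrbitalIntegral_mk_archDiagTorus_comp_eq_prod_mul_archStableOrbitalIntegral` with `Λ_w = −2M·p!(3−p)!`, so that `K_α⁻¹ · ∏_w Λ_w = ∏_w (−2M_w)`.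
* §1 `kottwitzSign_diagonal_circle_comp_perm_eq_neg_one_iff` (`e(diag(z⁰∘σ)) = −1 ↔ cw σ`, ★ FILE A `…_of_slots`), `…_cast_eq_ite`, `pos_iff_pos_of_mk_circleDiagonal_comp_eq` (`cw` is a
  class function, ★ `kottwitzSign_coe_out_mk_archLocal`);
* §2 **`card_filter_mk_circleDiagonal_comp_wall_eq`** — THE COUNT: `#fibre(r) = (cw r ? p!(3−p)! : 2·p!(3−p)!)` (definite place: all six, ★ B-p17 exhaustion; indefinite: `2p` ∕ `2(3−p)`, ★ FILE D);
* §3 **`sum_filter_wallWeight_eq_neg_two_mul_mul_kottwitzSign`** — THE COEFFICIENT.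
HONEST LABEL: HC_CM is proved only modulo the 7 printed citations until rung 0 closes; this file is finite book-keeping and pays nothing by itself.

## References
* [Rogawski1990] J. D. Rogawski, *Automorphic Representations of Unitary Groups in Three Variables*, Ann. of Math. Stud. 123 (1990), §8.2 Prop. 8.2.1 p. 118, p. 123 («`−2c F′(γ₀′)`»),
  p. 124, §4.1 (4.1.2) pp. 39–40.
* [BrockerTomDieck1985] Th. Bröcker, T. tom Dieck, *Representations of Compact Lie Groups*, GTM 98 (1985), IV (3.2).
-/

set_option autoImplicit false

noncomputable section

open Matrix Equiv Finset NumberField NumberField.InfinitePlace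
open Literature.LinearAlgebra.Matrix Literature.NumberTheory.Automorphic Literature.NumberTheory.Automorphic.UnitaryGroup
open scoped MatrixGroups ComplexConjugate NNReal

namespace Literature.NumberTheory.Rogawski1990

variable (L : Type) [Field L] (α : Fin 3 → L) (w : {w : InfinitePlace L // IsComplex w})

/-! ## §1 The sign of a relabelled wall point and the class function `cw` -/

/-- On the wall `z⁰_0 = z⁰_2 ≠ z⁰_1`: `z⁰ j = z⁰ 1 ↔ j = 1`. [folklore] -/
private theorem wall_apply_eq_apply_one_iff {z₀ : Fin 3 → Circle} (h02 : z₀ 0 = z₀ 2) (h01 : z₀ 0 ≠ z₀ 1) (j : Fin 3) : z₀ j = z₀ 1 ↔ j = 1 := by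
  fin_cases j
  · simpa using h01
  · simp
  · simpa using fun h => h01 (h02.trans h)

/-- On the wall, off the slot `1` the point is constant. [folklore] -/
private theorem wall_apply_eq_of_ne_one {z₀ : Fin 3 → Circle} (h02 : z₀ 0 = z₀ 2) (i j : Fin 3) (hi : i ≠ 1) (hj : j ≠ 1) : z₀ i = z₀ j := by
  have key : ∀ m : Fin 3, m ≠ 1 → z₀ m = z₀ 0 := by
    intro m hm
    fin_cases m
    · rfl
    · exact absurd rfl hm
    · exact h02.symm
  rw [key i hi, key j hj]

/-- **`e(diag(z⁰ ∘ σ)) = −1 ↔ cw σ`**: the matrix Kottwitz sign of the relabelled wall point for the form `σ_w(diag α)` is `−1` iff the two coalescing eigenvalues sit in slots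
`σ⁻¹0, σ⁻¹2` of weights of the SAME sign (compact centraliser `U(2) × U(1)`; ★ FILE A `kottwitzSign_conj_diagonal_eq_neg_one_iff_of_slots` at the slots `(σ⁻¹0, σ⁻¹1, σ⁻¹2)`).
[cite: Rogawski1990, §8.2 p. 117, Prop. 8.2.1 p. 118; §4.1 (4.1.2) p. 39] -/
theorem kottwitzSign_diagonal_circle_comp_perm_eq_neg_one_iff (hα : ∀ i, α i ≠ 0) (hreal : ∀ i, (w.1.embedding (α i)).im = 0)
    {z₀ : Fin 3 → Circle} (h02 : z₀ 0 = z₀ 2) (h01 : z₀ 0 ≠ z₀ 1) (σ : Perm (Fin 3)) :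
    kottwitzSign (starRingEnd ℂ) (diagonal fun i => w.1.embedding (α i)) (diagonal fun i => ((z₀ ∘ ⇑σ) i : ℂ)) = -1 ↔
      0 < (w.1.embedding (α (σ⁻¹ 0))).re * (w.1.embedding (α (σ⁻¹ 2))).re := by
  have hσ1 : ∀ m : Fin 3, σ m = 1 ↔ m = σ⁻¹ 1 := fun m => by
    show σ m = 1 ↔ m = σ.symm 1
    exact (Equiv.eq_symm_apply (e := σ)).symm
  have hσσ : σ (σ⁻¹ 1) = 1 := σ.apply_symm_apply 1
  have hs : ∀ m : Fin 3, ((z₀ ∘ ⇑σ) m : ℂ) = ((z₀ ∘ ⇑σ) (σ⁻¹ 1) : ℂ) ↔ m = σ⁻¹ 1 := fun m => by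
    simp only [Function.comp_apply]
    rw [hσσ, ← hσ1 m, ← wall_apply_eq_apply_one_iff h02 h01 (σ m)]
    exact ⟨fun h => Circle.ext h, fun h => congrArg _ h⟩
  have hdd : ∀ m m' : Fin 3, m ≠ σ⁻¹ 1 → m' ≠ σ⁻¹ 1 → ((z₀ ∘ ⇑σ) m : ℂ) = ((z₀ ∘ ⇑σ) m' : ℂ) := fun m m' hm hm' => by
    simp only [Function.comp_apply]
    rw [wall_apply_eq_of_ne_one h02 (σ m) (σ m') (fun h => hm ((hσ1 m).mp h)) (fun h => hm' ((hσ1 m').mp h))]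
  have hne : ∀ i, w.1.embedding (α i) ≠ 0 := fun i => (_root_.map_ne_zero w.1.embedding).mpr (hα i)
  have h01' : σ⁻¹ 0 ≠ σ⁻¹ 1 := fun h => absurd (σ⁻¹.injective h) (by decide)
  have h21' : σ⁻¹ 2 ≠ σ⁻¹ 1 := fun h => absurd (σ⁻¹.injective h) (by decide)
  have h02' : σ⁻¹ 0 ≠ σ⁻¹ 2 := fun h => absurd (σ⁻¹.injective h) (by decide)
  rw [kottwitzSign_conj_diagonal_eq_neg_one_iff_of_slots (t := fun i => w.1.embedding (α i)) hs hdd (fun i => hreal i) hne h01' h21' h02',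
    Complex.mul_re, hreal, hreal, mul_zero, sub_zero]

/-- The sign as a complex number: `e(diag(z⁰ ∘ σ)) = (cw σ ? −1 : 1)`. [cite: Rogawski1990, §4.1 (4.1.2) p. 39; §8.2 p. 117] -/
theorem kottwitzSign_diagonal_circle_comp_perm_cast_eq_ite (hα : ∀ i, α i ≠ 0) (hreal : ∀ i, (w.1.embedding (α i)).im = 0)
    {z₀ : Fin 3 → Circle} (h02 : z₀ 0 = z₀ 2) (h01 : z₀ 0 ≠ z₀ 1) (σ : Perm (Fin 3)) :
    ((((kottwitzSign (starRingEnd ℂ) (diagonal fun i => w.1.embedding (α i)) (diagonal fun i => ((z₀ ∘ ⇑σ) i : ℂ)) : ℤˣ) : ℤ) : ℂ)) =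
      if 0 < (w.1.embedding (α (σ⁻¹ 0))).re * (w.1.embedding (α (σ⁻¹ 2))).re then -1 else 1 := by
  have hiff := kottwitzSign_diagonal_circle_comp_perm_eq_neg_one_iff L α w hα hreal h02 h01 σ
  split_ifs with h
  · rw [hiff.mpr h]; push_cast; simp
  · rcases kottwitzSign_eq_one_or_eq_neg_one (σ := starRingEnd ℂ) (H := diagonal fun i => w.1.embedding (α i)) (diagonal fun i => ((z₀ ∘ ⇑σ) i : ℂ)) with h1 | h1
    · rw [h1]; push_cast; simp
    · exact absurd (hiff.mp h1) h

/-- **`cw` IS A CLASS FUNCTION**: relabelled wall points in the same `G_w(α)`-class have the same compactness type (the Kottwitz sign is a class invariant, ★ `kottwitzSign_coe_out_mk_archLocal`).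
[cite: Rogawski1990, §4.1 (4.1.2) p. 39; §8.2 Prop. 8.2.1 p. 118] -/
theorem pos_iff_pos_of_mk_circleDiagonal_comp_eq (hα : ∀ i, α i ≠ 0) (hreal : ∀ i, (w.1.embedding (α i)).im = 0)
    {z₀ : Fin 3 → Circle} (h02 : z₀ 0 = z₀ 2) (h01 : z₀ 0 ≠ z₀ 1) {σ r : Perm (Fin 3)}
    (h : ConjClasses.mk (⟨circleDiagonal 3 (z₀ ∘ ⇑σ), circleDiagonal_mem_archLocal_diagonal L 3 α w (z₀ ∘ ⇑σ)⟩ : archLocal L 3 (diagonal α) w) =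
      ConjClasses.mk (⟨circleDiagonal 3 (z₀ ∘ ⇑r), circleDiagonal_mem_archLocal_diagonal L 3 α w (z₀ ∘ ⇑r)⟩ : archLocal L 3 (diagonal α) w)) :
    0 < (w.1.embedding (α (σ⁻¹ 0))).re * (w.1.embedding (α (σ⁻¹ 2))).re ↔ 0 < (w.1.embedding (α (r⁻¹ 0))).re * (w.1.embedding (α (r⁻¹ 2))).re := by
  rw [← kottwitzSign_diagonal_circle_comp_perm_eq_neg_one_iff L α w hα hreal h02 h01 σ,
    ← kottwitzSign_diagonal_circle_comp_perm_eq_neg_one_iff L α w hα hreal h02 h01 r]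
  have hform : (diagonal α).map w.1.embedding = diagonal fun i => w.1.embedding (α i) := diagonal_map (map_zero _)
  have hσ := kottwitzSign_coe_out_mk_archLocal L α w (⟨circleDiagonal 3 (z₀ ∘ ⇑σ), circleDiagonal_mem_archLocal_diagonal L 3 α w (z₀ ∘ ⇑σ)⟩ : archLocal L 3 (diagonal α) w)
  have hr := kottwitzSign_coe_out_mk_archLocal L α w (⟨circleDiagonal 3 (z₀ ∘ ⇑r), circleDiagonal_mem_archLocal_diagonal L 3 α w (z₀ ∘ ⇑r)⟩ : archLocal L 3 (diagonal α) w)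
  rw [h] at hσ
  rw [hσ, hform] at hr
  simp only [coe_circleDiagonal] at hr
  rw [hr]

/-! ## §2 The count: `#fibre(r) = (cw r ? p!(3−p)! : 2·p!(3−p)!)` -/

open scoped Classical in
/-- `p = [0 < e(r⁻¹0)] + [0 < e(r⁻¹1)] + [0 < e(r⁻¹2)]` — the number of positive weights read through any relabelling. [folklore] -/
private theorem card_filter_pos_eq_sum_three (e : Fin 3 → ℝ) (r : Perm (Fin 3)) :
    (univ.filter fun i => 0 < e i).card =
      (if 0 < e (r⁻¹ 0) then 1 else 0) + (if 0 < e (r⁻¹ 1) then 1 else 0) + (if 0 < e (r⁻¹ 2) then 1 else 0) := by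
  rw [Finset.card_filter, ← Equiv.sum_comp r⁻¹ (fun i => if 0 < e i then 1 else 0), Fin.sum_univ_three]

open scoped Classical in
/-- **THE COUNT.**  For `α_i ≠ 0` with `σ_w α_i` real and a wall point `z⁰`: the fibre of `σ ↦ ⟦diag(z⁰∘σ)⟧` through `r` has `p!(3−p)!` elements if `cw r` and `2·p!(3−p)!` otherwise
(`p = #{i ∣ 0 < re σ_w α_i}`): at a definite place all six relabellings are conjugate (★ B-p17 `exists_conj_circleDiagonal_perm_of_pos_iff`) and every wall is compact (`6 = 3!·0!`); at an
indefinite place the two classes have `2p` and `2(3−p)` relabellings (★ FILE D), of which the one carrying the odd eigenvalue over the MAJORITY sign is the noncompact one (`4 = 2·2`), the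
other the compact one (`2`). [cite: Rogawski1990, §8.2 Prop. 8.2.1 p. 118; §8.3 p. 122] [cite: BrockerTomDieck1985, IV (3.2)] -/
theorem card_filter_mk_circleDiagonal_comp_wall_eq (hα : ∀ i, α i ≠ 0) (hreal : ∀ i, (w.1.embedding (α i)).im = 0)
    {z₀ : Fin 3 → Circle} (h02 : z₀ 0 = z₀ 2) (h01 : z₀ 0 ≠ z₀ 1) (r : Perm (Fin 3)) :
    (univ.filter fun σ : Perm (Fin 3) =>
        ConjClasses.mk (⟨circleDiagonal 3 (z₀ ∘ ⇑σ), circleDiagonal_mem_archLocal_diagonal L 3 α w (z₀ ∘ ⇑σ)⟩ : archLocal L 3 (diagonal α) w) =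
          ConjClasses.mk (⟨circleDiagonal 3 (z₀ ∘ ⇑r), circleDiagonal_mem_archLocal_diagonal L 3 α w (z₀ ∘ ⇑r)⟩ : archLocal L 3 (diagonal α) w)).card =
      if 0 < (w.1.embedding (α (r⁻¹ 0))).re * (w.1.embedding (α (r⁻¹ 2))).re then
        ((univ.filter fun i => 0 < (w.1.embedding (α i)).re).card.factorial * (3 - (univ.filter fun i => 0 < (w.1.embedding (α i)).re).card).factorial)
      else 2 * ((univ.filter fun i => 0 < (w.1.embedding (α i)).re).card.factorial * (3 - (univ.filter fun i => 0 < (w.1.embedding (α i)).re).card).factorial) := by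
  set e : Fin 3 → ℝ := fun i => (w.1.embedding (α i)).re with he_def
  have he : ∀ i, e i ≠ 0 := fun i => re_embedding_ne_zero L 3 α w hα hreal i
  have hU := mem_archLocal_diagonal_iff_mem_unitaryGroupOfForm L 3 α w hreal
  have hk : ∀ j, z₀ j = z₀ 1 ↔ j = 1 := wall_apply_eq_apply_one_iff h02 h01
  have hzz : ∀ i j : Fin 3, i ≠ 1 → j ≠ 1 → z₀ i = z₀ j := wall_apply_eq_of_ne_one h02
  have hp := card_filter_pos_eq_sum_three e r
  -- the three signs read through `r`
  change (univ.filter fun σ : Perm (Fin 3) => _).card = if 0 < e (r⁻¹ 0) * e (r⁻¹ 2) then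
      ((univ.filter fun i => 0 < e i).card.factorial * (3 - (univ.filter fun i => 0 < e i).card).factorial)
    else 2 * ((univ.filter fun i => 0 < e i).card.factorial * (3 - (univ.filter fun i => 0 < e i).card).factorial)
  by_cases hdef : (∀ i, 0 < e i) ∨ (∀ i, e i < 0)
  · -- DEFINITE place: one class, all walls compact
    have hall : ∀ σ : Perm (Fin 3), ConjClasses.mk (⟨circleDiagonal 3 (z₀ ∘ ⇑σ), circleDiagonal_mem_archLocal_diagonal L 3 α w (z₀ ∘ ⇑σ)⟩ : archLocal L 3 (diagonal α) w) =
        ConjClasses.mk (⟨circleDiagonal 3 (z₀ ∘ ⇑r), circleDiagonal_mem_archLocal_diagonal L 3 α w (z₀ ∘ ⇑r)⟩ : archLocal L 3 (diagonal α) w) := by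
      intro σ
      have hs : 0 < e (σ⁻¹ 1) ↔ 0 < e (r⁻¹ 1) := by
        rcases hdef with hpos | hneg
        · exact ⟨fun _ => hpos _, fun _ => hpos _⟩
        · exact ⟨fun h => absurd h (not_lt.mpr (hneg _).le), fun h => absurd h (not_lt.mpr (hneg _).le)⟩
      obtain ⟨g, hg⟩ := exists_conj_circleDiagonal_perm_of_pos_iff (z := z₀) (k := 1) he hk hzz σ⁻¹ r⁻¹ hs
      have hσ : (fun i => z₀ ((σ⁻¹ : Perm (Fin 3)).symm i)) = z₀ ∘ ⇑σ := by
        funext i; simp only [Function.comp_apply, Perm.inv_def, Equiv.symm_symm]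
      have hr' : (fun i => z₀ ((r⁻¹ : Perm (Fin 3)).symm i)) = z₀ ∘ ⇑r := by
        funext i; simp only [Function.comp_apply, Perm.inv_def, Equiv.symm_symm]
      rw [hσ, hr'] at hg
      refine ConjClasses.mk_eq_mk_iff_isConj.mpr (isConj_iff.mpr ⟨⟨(g : GL (Fin 3) ℂ), (hU _).mpr g.2⟩, Subtype.ext ?_⟩)
      simpa only [Subgroup.coe_mul, Subgroup.coe_inv] using hg
    rw [Finset.filter_true_of_mem fun σ _ => hall σ, Finset.card_univ, Fintype.card_perm, Fintype.card_fin]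
    have hP : 0 < e (r⁻¹ 0) * e (r⁻¹ 2) := by
      rcases hdef with hpos | hneg
      · exact mul_pos (hpos _) (hpos _)
      · exact mul_pos_of_neg_of_neg (hneg _) (hneg _)
    rw [if_pos hP]
    rcases hdef with hpos | hneg
    · rw [Finset.filter_true_of_mem fun i _ => hpos i, Finset.card_univ, Fintype.card_fin]; decide
    · rw [Finset.filter_false_of_mem fun i _ => not_lt.mpr (hneg i).le, Finset.card_empty]; decide
  · -- INDEFINITE place: a positive and a negative slot exist
    push Not at hdef
    obtain ⟨⟨ip', hip'⟩, ⟨im', him'⟩⟩ := hdef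
    have hip : ∃ ip, 0 < e ip := ⟨im', lt_of_le_of_ne him' (he im').symm⟩
    have him : ∃ im, e im < 0 := ⟨ip', lt_of_le_of_ne hip' (he ip')⟩
    obtain ⟨ip, hip⟩ := hip
    obtain ⟨im, him⟩ := him
    have hsign : ∀ i, ¬ 0 < e i ↔ e i < 0 := fun i => ⟨fun h => lt_of_le_of_ne (not_lt.mp h) (he i), fun h => not_lt.mpr h.le⟩
    have hneg_card : (univ.filter fun i => e i < 0).card = 3 - (univ.filter fun i => 0 < e i).card := by
      have h3 : (univ.filter fun i => 0 < e i).card + (univ.filter fun i => e i < 0).card = 3 := by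
        have h := Finset.card_filter_add_card_filter_not (s := (univ : Finset (Fin 3))) (fun i => 0 < e i)
        have hfilt : (univ.filter fun i => e i < 0) = univ.filter fun i => ¬ 0 < e i := Finset.filter_congr fun i _ => (hsign i).symm
        rw [hfilt, h, Finset.card_univ, Fintype.card_fin]
      omega
    rcases mk_circleDiagonal_comp_eq_or (archLocal L 3 (diagonal α) w) hU he hk hzz hip him r with hr | hr
    · -- the class `C₊`: `b` over a POSITIVE slot, `2p` relabellings
      have hb : 0 < e (r⁻¹ 1) := (mk_circleDiagonal_comp_eq_mk_swap_pos_iff (archLocal L 3 (diagonal α) w) hU he hk hzz hip him r).mp hr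
      rw [Finset.filter_congr (fun σ _ => by rw [hr]), card_filter_mk_circleDiagonal_comp_eq_swap_pos (archLocal L 3 (diagonal α) w) hU he hk hzz hip him, hp,
        if_pos hb]
      by_cases h0 : 0 < e (r⁻¹ 0) <;> by_cases h2 : 0 < e (r⁻¹ 2)
      · -- all three positive: impossible at an indefinite place
        exfalso
        have : ∀ i, 0 < e i := fun i => by
          obtain ⟨j, rfl⟩ := r⁻¹.surjective i
          fin_cases j
          · exact h0
          · exact hb
          · exact h2
        exact absurd (this im) (not_lt.mpr him.le)
      · have hP : ¬ 0 < e (r⁻¹ 0) * e (r⁻¹ 2) := not_lt.mpr (mul_nonpos_iff.mpr (Or.inl ⟨h0.le, (not_lt.mp h2)⟩))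
        rw [if_pos h0, if_neg h2, if_neg hP]; decide
      · have hP : ¬ 0 < e (r⁻¹ 0) * e (r⁻¹ 2) := not_lt.mpr (mul_nonpos_iff.mpr (Or.inr ⟨not_lt.mp h0, h2.le⟩))
        rw [if_neg h0, if_pos h2, if_neg hP]; decide
      · have hP : 0 < e (r⁻¹ 0) * e (r⁻¹ 2) := mul_pos_of_neg_of_neg ((hsign _).mp h0) ((hsign _).mp h2)
        rw [if_neg h0, if_neg h2, if_pos hP]; decide
    · -- the class `C₋`: `b` over a NEGATIVE slot, `2·#{e<0}` relabellings
      have hb : e (r⁻¹ 1) < 0 := (mk_circleDiagonal_comp_eq_mk_swap_neg_iff (archLocal L 3 (diagonal α) w) hU he hk hzz hip him r).mp hr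
      have hb' : ¬ 0 < e (r⁻¹ 1) := not_lt.mpr hb.le
      rw [Finset.filter_congr (fun σ _ => by rw [hr]), card_filter_mk_circleDiagonal_comp_eq_swap_neg (archLocal L 3 (diagonal α) w) hU he hk hzz hip him, hneg_card, hp,
        if_neg hb']
      by_cases h0 : 0 < e (r⁻¹ 0) <;> by_cases h2 : 0 < e (r⁻¹ 2)
      · have hP : 0 < e (r⁻¹ 0) * e (r⁻¹ 2) := mul_pos h0 h2
        rw [if_pos h0, if_pos h2, if_pos hP]; decide
      · have hP : ¬ 0 < e (r⁻¹ 0) * e (r⁻¹ 2) := not_lt.mpr (mul_nonpos_iff.mpr (Or.inl ⟨h0.le, (not_lt.mp h2)⟩))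
        rw [if_pos h0, if_neg h2, if_neg hP]; decide
      · have hP : ¬ 0 < e (r⁻¹ 0) * e (r⁻¹ 2) := not_lt.mpr (mul_nonpos_iff.mpr (Or.inr ⟨not_lt.mp h0, h2.le⟩))
        rw [if_neg h0, if_pos h2, if_neg hP]; decide
      · -- all three negative: impossible at an indefinite place
        exfalso
        have : ∀ i, e i < 0 := fun i => by
          obtain ⟨j, rfl⟩ := r⁻¹.surjective i
          fin_cases j
          · exact (hsign _).mp h0
          · exact hb
          · exact (hsign _).mp h2
        exact absurd (this ip) (not_lt.mpr hip.le)

/-! ## §3 The coefficient -/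

open scoped Classical in
/-- **THE CLASS COEFFICIENT OF THE END STATE.**  With `cw σ :⇔ 0 < re σ_w(α_{σ⁻¹0})·re σ_w(α_{σ⁻¹2})`, noncompact constants `c(σ) = −M` (`¬cw σ`) and compact masses `mass(σ) = M`
(`cw σ`), for every `r ∈ S₃`:
`Σ_{σ : ⟦diag(z⁰∘σ)⟧ = ⟦diag(z⁰∘r)⟧} (cw σ ? 2 : c σ) · (cw σ ? mass σ : 1) = (−2·M·p!(3−p)!) · e(diag(z⁰∘r))` — the hypothesis `hΛ` of (D2-comb) with `Λ_w = −2M·p!(3−p)!`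
(print: the jump is «a non-zero constant times `Φ^st(γ₀, f)`», the constant being `−2c` per place with `e(γ₀) = 1`, `e(γ₀′) = −1`). [cite: Rogawski1990, §8.2 pp. 123–124; §4.1 (4.1.2) p. 39] -/
theorem sum_filter_wallWeight_eq_neg_two_mul_mul_kottwitzSign (hα : ∀ i, α i ≠ 0) (hreal : ∀ i, (w.1.embedding (α i)).im = 0)
    {z₀ : Fin 3 → Circle} (h02 : z₀ 0 = z₀ 2) (h01 : z₀ 0 ≠ z₀ 1)
    (cst : Perm (Fin 3) → ℂ) (mass : Perm (Fin 3) → ℝ≥0) (M : ℝ)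
    (hC : ∀ σ : Perm (Fin 3), ¬ 0 < (w.1.embedding (α (σ⁻¹ 0))).re * (w.1.embedding (α (σ⁻¹ 2))).re → cst σ = -M)
    (hM : ∀ σ : Perm (Fin 3), 0 < (w.1.embedding (α (σ⁻¹ 0))).re * (w.1.embedding (α (σ⁻¹ 2))).re → ((mass σ : ℝ≥0) : ℝ) = M)
    (r : Perm (Fin 3)) :
    ∑ σ ∈ univ.filter (fun σ : Perm (Fin 3) =>
        ConjClasses.mk (⟨circleDiagonal 3 (z₀ ∘ ⇑σ), circleDiagonal_mem_archLocal_diagonal L 3 α w (z₀ ∘ ⇑σ)⟩ : archLocal L 3 (diagonal α) w) =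
          ConjClasses.mk (⟨circleDiagonal 3 (z₀ ∘ ⇑r), circleDiagonal_mem_archLocal_diagonal L 3 α w (z₀ ∘ ⇑r)⟩ : archLocal L 3 (diagonal α) w)),
        (if 0 < (w.1.embedding (α (σ⁻¹ 0))).re * (w.1.embedding (α (σ⁻¹ 2))).re then (2 : ℂ) else cst σ) *
          (((if 0 < (w.1.embedding (α (σ⁻¹ 0))).re * (w.1.embedding (α (σ⁻¹ 2))).re then mass σ else 1 : ℝ≥0) : ℝ) : ℂ) =
      (-(2 : ℂ) * M * ((univ.filter fun i => 0 < (w.1.embedding (α i)).re).card.factorial *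
          (3 - (univ.filter fun i => 0 < (w.1.embedding (α i)).re).card).factorial : ℕ)) *
        ((((kottwitzSign (starRingEnd ℂ) (diagonal fun i => w.1.embedding (α i)) (diagonal fun i => ((z₀ ∘ ⇑r) i : ℂ)) : ℤˣ) : ℤ) : ℂ)) := by
  -- on the fibre the summand is the constant `(cw r ? 2M : −M)`
  have hconst : ∀ σ ∈ univ.filter (fun σ : Perm (Fin 3) =>
        ConjClasses.mk (⟨circleDiagonal 3 (z₀ ∘ ⇑σ), circleDiagonal_mem_archLocal_diagonal L 3 α w (z₀ ∘ ⇑σ)⟩ : archLocal L 3 (diagonal α) w) =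
          ConjClasses.mk (⟨circleDiagonal 3 (z₀ ∘ ⇑r), circleDiagonal_mem_archLocal_diagonal L 3 α w (z₀ ∘ ⇑r)⟩ : archLocal L 3 (diagonal α) w)),
      (if 0 < (w.1.embedding (α (σ⁻¹ 0))).re * (w.1.embedding (α (σ⁻¹ 2))).re then (2 : ℂ) else cst σ) *
          (((if 0 < (w.1.embedding (α (σ⁻¹ 0))).re * (w.1.embedding (α (σ⁻¹ 2))).re then mass σ else 1 : ℝ≥0) : ℝ) : ℂ) =
        (if 0 < (w.1.embedding (α (r⁻¹ 0))).re * (w.1.embedding (α (r⁻¹ 2))).re then 2 * (M : ℂ) else -(M : ℂ)) := by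
    intro σ hσ
    have hiff := pos_iff_pos_of_mk_circleDiagonal_comp_eq L α w hα hreal h02 h01 (Finset.mem_filter.mp hσ).2
    by_cases hr : 0 < (w.1.embedding (α (r⁻¹ 0))).re * (w.1.embedding (α (r⁻¹ 2))).re
    · have hs : 0 < (w.1.embedding (α (σ⁻¹ 0))).re * (w.1.embedding (α (σ⁻¹ 2))).re := hiff.mpr hr
      rw [if_pos hs, if_pos hs, if_pos hr, hM σ hs]
    · have hs : ¬ 0 < (w.1.embedding (α (σ⁻¹ 0))).re * (w.1.embedding (α (σ⁻¹ 2))).re := fun h => hr (hiff.mp h)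
      rw [if_neg hs, if_neg hs, if_neg hr, hC σ hs]
      push_cast
      ring
  rw [Finset.sum_congr rfl hconst, Finset.sum_const, card_filter_mk_circleDiagonal_comp_wall_eq L α w hα hreal h02 h01 r,
    kottwitzSign_diagonal_circle_comp_perm_cast_eq_ite L α w hα hreal h02 h01 r, nsmul_eq_mul]
  split_ifs with hP <;> push_cast <;> ring

end Literature.NumberTheory.Rogawski1990

end
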